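import Mathlib

/-!
# Venture AbcShadow — SH-27 STATEMENT: `a² + b²ᵖ = c⁵` has no non-trivial proper solution (row SH-27: `p = 17`)

HONEST FRAMING. Statement file of the work-bound cell `abc-shadow` (row SH-27 of its census; typer seat `abc-shadow-typ-4`).
This file PROVES NOTHING about the equation: it types the TARGET of the row as a plain `Prop` in the words of [Che10] =
I. Chen, "On the equation `a² + b²ᵖ = c⁵`", Acta Arith. 143 (2010) 345–375, p.345: "A solution `(a, b, c) ∈ ℤ³` to the
equation `a² + b²ᵖ = c⁵` is said to be non-trivial if `ab ≠ 0` and proper if `(a, b, c) = 1`." and Theorem 1: "Let `p > 17`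
be a prime such that `p ≡ 1 (mod 4)`. Then the equation `a² + b²ᵖ = c⁵` does not have any non-trivial proper solutions."
The row SH-27 is the EXCLUDED prime `p = 17` (`a² + b³⁴ = c⁵`): `SH27 17`. The conditional derivation from NAMED print
hypotheses + the cell's COMPUTED newform data + KERNEL curve-side tables is `SH27/RowP17.lean`. ADJACENT result
(generalized Fermat, signature `(2, 2p, 5)`), NOT abc: nothing here is a claim on the abc conjecture or on any summit, and
nothing here takes a side on IUT.
-/

namespace Summit.Ventures.AbcShadow

/-- **Proper** triple [Che10, p.345]: "`(a, b, c) = 1`" — every common divisor of `a, b, c` is a unit.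
[cite: Chen2010, p.345 (definition)] -/
def SH27.IsProper (a b c : ℤ) : Prop := ∀ d : ℤ, d ∣ a → d ∣ b → d ∣ c → IsUnit d

/-- **SH-27 target family** [Che10, Thm 1 (for `p > 17`, `p ≡ 1 (mod 4)`); the cell's row is `p = 17`]: the equation
`a² + b²ᵖ = c⁵` has NO non-trivial (`ab ≠ 0`) proper (`(a, b, c) = 1`) solution in integers. Plain `Prop`; nothing is
asserted. [cite: Chen2010, Thm 1 p.345 (statement shape; p = 17 is NOT covered by print)] -/
def SH27 (p : ℕ) : Prop :=
  ∀ a b c : ℤ, a ^ 2 + b ^ (2 * p) = c ^ 5 → SH27.IsProper a b c → a * b ≠ 0 → False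

/-- **[Che10, Theorem 1] as printed** (a NAMED statement, not used by the row; recorded so that the row's relation to print is
explicit): for every prime `p > 17` with `p ≡ 1 (mod 4)`, `SH27 p`. [cite: Chen2010, Thm 1 p.345] -/
def Che10Theorem1 : Prop := ∀ p : ℕ, p.Prime → 17 < p → p % 4 = 1 → SH27 p

end Summit.Ventures.AbcShadow
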